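import Literature.AlgebraicGeometry.HodgeTheory.AbelianVarietyAnalyticTypeProductsPowers
import Mathlib.RingTheory.Polynomial.GaussLemma
import Mathlib.Algebra.Polynomial.Expand
import HarnessLib

/-!
# Twists `δ ↦ δ^e` (`gcd(e, m) = 1`): `Φ_m(δ^e) = 0` again, and the analytic type is transported, `n_{η^e}(δ^e) = n_η(δ)`

Family `hodge`, lane `lit-hodgefound` (seat p03, GEN 35 «the analytic type of a finite-order automorphism», row g35-#8; sequel of
g35-#5 `AbelianVarietyAnalyticTypeProductsPowers` and g35-#1 `AbelianVarietyCyclotomicAutomorphismMultiplicities`), topic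
`Literature/AlgebraicGeometry/HodgeTheory`.  Theorems only: no definition, no instance, no named fact (net Literature debt 0).

Zarhin attaches to `δ` with `Φ_p(δ) = 0` the embeddings `σ_j : ℚ(ζ_p) ↪ ℂ`, `ζ_p ↦ ζ_p^j` and the multiplicities `a_j = n_{ζ^j}(δ)`
(«`𝐣(h₁h₂) ≡ 𝐣(h₁)𝐣(h₂) mod p`»).  Replacing the generator `δ` of `μ_p ⊂ Aut(X)` by another generator `δ^e` (`p ∤ e`) composes
each `σ_j` with the Galois automorphism `ζ ↦ ζ^e`, so the multiplicity function is transported along `h ↦ he`: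
`n_{η^e}(δ^e) = n_η(δ)`, equivalently `n_η(δ^e) = n_{η^d}(δ)` for `ed ≡ 1 (mod m)`.  This file proves the transport for any
`φ` with `φ^m = 1` (from g35-#5 `eigenMultiplicity_pow_eq_sum_filter`: `n_η(φ^e) = Σ_{ζ^m = 1, ζ^e = η} n_ζ(φ)`, the fibre
being the single root `η^d`), and that the cyclotomic equation is inherited by coprime powers: `Φ_m(δ) = 0 ⇒ Φ_m(δ^e) = 0`
(because `Φ_m ∣ Φ_m(X^e)` in `ℤ[X]`: every primitive `m`-th root `ζ` has `ζ^e` primitive, `Φ_m = minpoly_ℚ(ζ)`, and Gauss's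
lemma) — so every statement of GEN 35 about `δ` applies verbatim to `δ^e`, with Zarhin's function re-indexed by `h ↦ h·e⁻¹`.

## Sources, verbatim (held text `paper:arxiv-2109.06794`)

Yu. G. Zarhin, *Jacobians with automorphisms of prime order*, Math. Research Reports (2021) = arXiv:2109.06794, §1 (chunk p0003
L9–L18) «`ζ_p ∈ μ_p ⊂ ℤ[ζ_p]` […] `δ` is a periodic automorphism of order `p` […] `ℤ[ζ_p] ↪ End(X)`, `ζ_p ↦ δ`»; (L38–L47, (1.4))
«the field embedding `σ_j : ℚ(ζ_p) ↪ ℂ` that sends `ζ_p` to `ζ_p^j` […] `ℚ(ζ_p)` acts on `Ω¹(X)` with multiplicities `a_j`»;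
(L106–L112, (1.5)–(1.6)) «`𝐣 : G = (ℤ/pℤ)^* → ℤ`, `(j mod p) ↦ j` […] `𝐣(h₁h₂) ≡ 𝐣(h₁)𝐣(h₂) mod p ∀ h₁, h₂ ∈ G`»; (chunk p0004
L8–L12, proof of Thm. 1.4) «Replacing `φ` by `φ^{p+1}` and taking into account that `(p+1)` is even and `δ^p` is the identity
automorphism of `X = J(𝒞)`, we may and will assume that `φ` induces `δ`» (powers prime to `p` of a generator are generators).
J.-P. Serre, *Linear Representations of Finite Groups* (1977), §5.1 (characters `χ_h(r^k) = w^{hk}` of the cyclic group), as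
in g34-#9 / g35-#5.  The divisibility `Φ_m ∣ Φ_m(X^e)` for `gcd(e, m) = 1` is derived here from Mathlib's
`cyclotomic_eq_minpoly_rat`, `IsPrimitiveRoot.pow_of_coprime` and `Monic.dvd_of_fraction_map_dvd_fraction_map` (Gauss).

## What is proved (namespace `Literature.AlgebraicGeometry.HodgeTheory.AbelianVariety`)

* §1 `cyclotomic_dvd_expand_cyclotomic_of_coprime` (`Φ_m ∣ expand_e Φ_m` in `ℤ[X]` for `gcd(e,m) = 1`, `0 < e`),
  **`eval₂_cyclotomic_pow_eq_zero_of_coprime`** (`Φ_m(δ) = 0 ⇒ Φ_m(δ^e) = 0`).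
* §2 (`φ^m = 1`, `0 < m`) **`eigenMultiplicity_pow_eq_of_mul_mod_eq_one`** (`ed ≡ 1 mod m`, `η^m = 1`: `n_η(φ^e) = n_{η^d}(φ)`),
  **`eigenMultiplicity_pow_pow_eq_of_coprime`** (`gcd(e,m) = 1`, `η^m = 1`: `n_{η^e}(φ^e) = n_η(φ)` — the type is transported),
  and for `Φ_m(δ) = 0`: `eigenMultiplicity_pow_eq_of_cyclotomic` (`n_η(δ^e) = n_{η^d}(δ)`), `eigenMultiplicity_pow_pow_eq_of_cyclotomic`
  (`n_{η^e}(δ^e) = n_η(δ)`), `eigenMultiplicity_pow_eq_zero_of_not_isPrimitiveRoot` (`n_η(δ^e) = 0` off the primitive roots).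
* §3 (prime `p`, `G = (ZMod p)ˣ`, `e, h ∈ G`) `eval₂_cyclotomic_pow_val_eq_zero` (`Φ_p(δ^{𝐣 e}) = 0`),
  **`eigenMultiplicity_pow_val_mul_eq`** (`n_{ζ^{he}}(δ^{𝐣 e}) = n_{ζ^h}(δ)`), **`eigenMultiplicity_pow_val_eq`**
  (`n_{ζ^h}(δ^{𝐣 e}) = n_{ζ^{h e⁻¹}}(δ)`: the function of `δ^{𝐣 e}` is `h ↦ 𝐚(h e⁻¹)`), `eigenMultiplicity_pow_pred_val_eq`
  (`n_{ζ^h}(δ^{p−1}) = n_{ζ^{−h}}(δ)`: the function of `δ⁻¹` is `h ↦ 𝐚(−h)`).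

## References

* [Zarhin2021PrimeOrderJacobians] Yu. G. Zarhin, Math. Research Reports (2021), arXiv:2109.06794, §1 (1.4)–(1.6), proof of
  Thm. 1.4 (chunks p0003–p0004).
* [SerreLinearRepresentations1977] J.-P. Serre, GTM 42 (1977), §5.1.
-/

noncomputable section

open CategoryTheory Polynomial

namespace Literature.AlgebraicGeometry.HodgeTheory

namespace AbelianVariety

/-! ## §1 `Φ_m ∣ Φ_m(X^e)` for `gcd(e, m) = 1`, hence `Φ_m(δ^e) = 0` -/

section CyclotomicPowers

variable {m : ℕ}

/-- **`Φ_m ∣ Φ_m(X^e)` in `ℤ[X]` for `gcd(e, m) = 1`, `0 < e`, `0 < m`:** every primitive `m`-th root `ζ` has `ζ^e` primitive,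
so `Φ_m(X^e)` vanishes at `ζ`, `Φ_m = minpoly_ℚ(ζ)` divides it over `ℚ`, and both are monic (Gauss's lemma) («the field
embedding `σ_j : ζ_p ↦ ζ_p^j`», `p ∤ j`). [cite: Zarhin2021PrimeOrderJacobians, §1 (1.4) (chunk p0003 L38–L47)] -/
theorem cyclotomic_dvd_expand_cyclotomic_of_coprime (hm : 0 < m) {e : ℕ} (he : e.Coprime m) (he0 : 0 < e) :
    cyclotomic m ℤ ∣ expand ℤ e (cyclotomic m ℤ) := by
  have hζ := Complex.isPrimitiveRoot_exp m hm.ne'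
  set ζ := Complex.exp (2 * Real.pi * Complex.I / m) with hζdef
  have hQ : cyclotomic m ℚ ∣ expand ℚ e (cyclotomic m ℚ) := by
    rw [cyclotomic_eq_minpoly_rat hζ hm]
    apply minpoly.dvd
    rw [expand_aeval, ← cyclotomic_eq_minpoly_rat hζ hm, aeval_def, eval₂_eq_eval_map, map_cyclotomic]
    exact (hζ.pow_of_coprime e he).isRoot_cyclotomic hm
  refine Monic.dvd_of_fraction_map_dvd_fraction_map (K := ℚ) (Monic.expand he0 (cyclotomic.monic m ℤ))
    (cyclotomic.monic m ℤ) ?_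
  rwa [map_expand, map_cyclotomic]

/-- **The cyclotomic equation is inherited by coprime powers: `Φ_m(δ) = 0 ⇒ Φ_m(δ^e) = 0`** for `gcd(e, m) = 1` — `δ^e` is
again a generator of `μ_m ⊂ Aut(X)` («Replacing `φ` by `φ^{p+1}` […] we may and will assume that `φ` induces `δ`»; `ζ_p ↦ ζ_p^j`).
[cite: Zarhin2021PrimeOrderJacobians, §1 (1.4), proof of Thm. 1.4 (chunk p0003 L38–L47, p0004 L8–L12)] -/
theorem eval₂_cyclotomic_pow_eq_zero_of_coprime {A : Motives.AbelianVariety ℂ} {δ : A ⟶ A} (hm : 0 < m)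
    (hδ : (cyclotomic m ℤ).eval₂ (Int.castRingHom (End A)) (End.of δ) = 0) {e : ℕ} (he : e.Coprime m) :
    (cyclotomic m ℤ).eval₂ (Int.castRingHom (End A)) (End.of δ ^ e) = 0 := by
  rcases Nat.eq_zero_or_pos e with rfl | he0
  · have hm1 : m = 1 := by simpa [Nat.coprime_zero_left] using he
    subst hm1
    rw [pow_zero, cyclotomic_one, eval₂_sub, eval₂_X, eval₂_one, sub_self]
  obtain ⟨Q, hQ⟩ := cyclotomic_dvd_expand_cyclotomic_of_coprime hm he he0
  have heq : algebraMap ℤ (End A) = Int.castRingHom _ := RingHom.ext_int _ _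
  have h1 : aeval (End.of δ) (cyclotomic m ℤ) = 0 := by rw [aeval_def, heq]; exact hδ
  have h2 : aeval (End.of δ ^ e) (cyclotomic m ℤ) = 0 := by
    rw [← expand_aeval, hQ, map_mul, h1, zero_mul]
  rw [aeval_def, heq] at h2
  exact h2

end CyclotomicPowers

/-! ## §2 The analytic type of a coprime power: `n_η(φ^e) = n_{η^d}(φ)` (`ed ≡ 1 mod m`), `n_{η^e}(φ^e) = n_η(φ)` -/

section Twist

variable {A : Motives.AbelianVariety ℂ} {φ : A ⟶ A} {m : ℕ}

/-- **`n_η(φ^e) = n_{η^d}(φ)` for `ed ≡ 1 (mod m)`, `φ^m = 1`, `η^m = 1`:** the fibre of `ζ ↦ ζ^e` over `η` inside `μ_m` is the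
single root `η^d` (from g35-#5 `n_η(φ^e) = Σ_{ζ^m=1, ζ^e=η} n_ζ(φ)`; «`𝐣(h₁h₂) ≡ 𝐣(h₁)𝐣(h₂) mod p`»: the function `𝐚` of `δ^e` is
`𝐚_δ` re-indexed by `h ↦ h e⁻¹`). [cite: Zarhin2021PrimeOrderJacobians, §1 (1.4)–(1.6) (chunk p0003 L38–L47, L106–L112)]
[cite: SerreLinearRepresentations1977, §5.1] -/
theorem eigenMultiplicity_pow_eq_of_mul_mod_eq_one (hm : 0 < m) (hφ : End.of φ ^ m = 1) {e d : ℕ}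
    (hed : e * d % m = 1 % m) {η : ℂ} (hη : η ^ m = 1) :
    eigenMultiplicity A (End.asHom (End.of φ ^ e)) η = eigenMultiplicity A φ (η ^ d) := by
  rw [eigenMultiplicity_pow_eq_sum_filter hm hφ e hη]
  have hset : ((nthRoots m (1 : ℂ)).toFinset.filter fun ζ ↦ ζ ^ e = η) = {η ^ d} := by
    ext ζ
    simp only [Finset.mem_filter, Multiset.mem_toFinset, mem_nthRoots hm, Finset.mem_singleton]
    constructor
    · rintro ⟨hζm, rfl⟩
      calc ζ = ζ ^ 1 := (pow_one ζ).symm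
        _ = ζ ^ (1 % m) := pow_eq_pow_mod 1 hζm
        _ = ζ ^ (e * d % m) := by rw [hed]
        _ = ζ ^ (e * d) := (pow_eq_pow_mod _ hζm).symm
        _ = (ζ ^ e) ^ d := pow_mul ζ e d
    · rintro rfl
      refine ⟨by rw [← pow_mul, mul_comm, pow_mul, hη, one_pow], ?_⟩
      calc (η ^ d) ^ e = η ^ (e * d) := by rw [← pow_mul, mul_comm]
        _ = η ^ (e * d % m) := pow_eq_pow_mod _ hη
        _ = η ^ (1 % m) := by rw [hed]
        _ = η ^ 1 := (pow_eq_pow_mod 1 hη).symm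
        _ = η := pow_one η
  rw [hset, Finset.sum_singleton]

/-- **The analytic type is transported by a twist: `n_{η^e}(φ^e) = n_η(φ)`** for `gcd(e, m) = 1`, `φ^m = 1`, `η^m = 1`
(«`σ_j : ζ_p ↦ ζ_p^j`»: the generator `δ^e` has Zarhin's function `h ↦ 𝐚_δ(h e⁻¹)`, i.e. the same multiset of multiplicities
attached to the Galois-conjugate roots). [cite: Zarhin2021PrimeOrderJacobians, §1 (1.4)–(1.6) (chunk p0003 L38–L47, L106–L112)]
[cite: SerreLinearRepresentations1977, §5.1] -/
theorem eigenMultiplicity_pow_pow_eq_of_coprime (hm : 0 < m) (hφ : End.of φ ^ m = 1) {e : ℕ} (he : e.Coprime m)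
    {η : ℂ} (hη : η ^ m = 1) :
    eigenMultiplicity A (End.asHom (End.of φ ^ e)) (η ^ e) = eigenMultiplicity A φ η := by
  rcases Nat.lt_or_ge 1 m with hm1 | hm1
  · obtain ⟨d, -, hd⟩ := Nat.exists_mul_mod_eq_one_of_coprime he hm1
    have hed : e * d % m = 1 % m := by rw [hd, Nat.mod_eq_of_lt hm1]
    rw [eigenMultiplicity_pow_eq_of_mul_mod_eq_one hm hφ hed (by rw [← pow_mul, mul_comm, pow_mul, hη, one_pow])]
    congr 1
    calc (η ^ e) ^ d = η ^ (e * d) := (pow_mul η e d).symm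
      _ = η ^ (e * d % m) := pow_eq_pow_mod _ hη
      _ = η ^ (1 % m) := by rw [hed]
      _ = η ^ 1 := (pow_eq_pow_mod 1 hη).symm
      _ = η := pow_one η
  · have hm1' : m = 1 := le_antisymm hm1 hm
    subst hm1'
    rw [pow_one] at hφ hη
    have hpe : End.of φ ^ e = End.of φ := by rw [hφ, one_pow]
    rw [hη, one_pow, hpe]

/-- **`n_η(δ^e) = n_{η^d}(δ)` for `Φ_m(δ) = 0`, `ed ≡ 1 (mod m)`, `η^m = 1`** (Zarhin's function of the generator `δ^e` is
`h ↦ 𝐚_δ(h·e⁻¹)`). [cite: Zarhin2021PrimeOrderJacobians, §1 (1.4)–(1.6) (chunk p0003 L38–L47, L106–L112)]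
[cite: SerreLinearRepresentations1977, §5.1] -/
theorem eigenMultiplicity_pow_eq_of_cyclotomic {δ : A ⟶ A} (hm : 0 < m)
    (hδ : (cyclotomic m ℤ).eval₂ (Int.castRingHom (End A)) (End.of δ) = 0) {e d : ℕ} (hed : e * d % m = 1 % m)
    {η : ℂ} (hη : η ^ m = 1) :
    eigenMultiplicity A (End.asHom (End.of δ ^ e)) η = eigenMultiplicity A δ (η ^ d) :=
  eigenMultiplicity_pow_eq_of_mul_mod_eq_one hm (pow_eq_one_of_cyclotomic hδ) hed hη

/-- **`n_{η^e}(δ^e) = n_η(δ)` for `Φ_m(δ) = 0`, `gcd(e, m) = 1`, `η^m = 1`.**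
[cite: Zarhin2021PrimeOrderJacobians, §1 (1.4)–(1.6) (chunk p0003 L38–L47, L106–L112)] [cite: SerreLinearRepresentations1977, §5.1] -/
theorem eigenMultiplicity_pow_pow_eq_of_cyclotomic {δ : A ⟶ A} (hm : 0 < m)
    (hδ : (cyclotomic m ℤ).eval₂ (Int.castRingHom (End A)) (End.of δ) = 0) {e : ℕ} (he : e.Coprime m)
    {η : ℂ} (hη : η ^ m = 1) :
    eigenMultiplicity A (End.asHom (End.of δ ^ e)) (η ^ e) = eigenMultiplicity A δ η :=
  eigenMultiplicity_pow_pow_eq_of_coprime hm (pow_eq_one_of_cyclotomic hδ) he hη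

/-- The eigenvalues of `ρ_a(δ^e)` are again primitive `m`-th roots: **`n_η(δ^e) = 0` unless `Φ_m(η) = 0`** (`gcd(e, m) = 1`).
[cite: Zarhin2021PrimeOrderJacobians, §1 (chunk p0003 L35–L47)] -/
theorem eigenMultiplicity_pow_eq_zero_of_not_isPrimitiveRoot {δ : A ⟶ A} (hm : 0 < m)
    (hδ : (cyclotomic m ℤ).eval₂ (Int.castRingHom (End A)) (End.of δ) = 0) {e : ℕ} (he : e.Coprime m)
    {η : ℂ} (hη : ¬ IsPrimitiveRoot η m) :
    eigenMultiplicity A (End.asHom (End.of δ ^ e)) η = 0 :=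
  eigenMultiplicity_eq_zero_of_not_isPrimitiveRoot hm (eval₂_cyclotomic_pow_eq_zero_of_coprime hm hδ he) hη

end Twist

/-! ## §3 Prime order, `G`-indexed: the generator `δ^{𝐣(e)}` (`e ∈ G`) has Zarhin's function `h ↦ 𝐚_δ(h e⁻¹)` -/

section PrimeTwist

variable {A : Motives.AbelianVariety ℂ} {δ : A ⟶ A} {p : ℕ} [hp : Fact p.Prime] {ζ : ℂ}

/-- `Φ_p(δ^{𝐣(e)}) = 0` for every `e ∈ G = (ℤ/pℤ)^*`: all generators of `μ_p = ⟨δ⟩` satisfy the cyclotomic equation.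
[cite: Zarhin2021PrimeOrderJacobians, §1 (1.4), proof of Thm. 1.4 (chunk p0003 L38–L47, p0004 L8–L12)] -/
theorem eval₂_cyclotomic_pow_val_eq_zero (hδ : (cyclotomic p ℤ).eval₂ (Int.castRingHom (End A)) (End.of δ) = 0)
    (e : (ZMod p)ˣ) :
    (cyclotomic p ℤ).eval₂ (Int.castRingHom (End A)) (End.of δ ^ (e : ZMod p).val) = 0 :=
  eval₂_cyclotomic_pow_eq_zero_of_coprime hp.out.pos hδ (ZMod.val_coe_unit_coprime e)

/-- **`n_{ζ^{he}}(δ^{𝐣(e)}) = n_{ζ^h}(δ)`** for `e, h ∈ G`: the twist by `e` transports the multiplicity at `ζ^h` to `ζ^{he}`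
(«`𝐣(h₁h₂) ≡ 𝐣(h₁)𝐣(h₂) mod p`», `ζ^{𝐣(he)} = (ζ^{𝐣 h})^{𝐣 e}`). [cite: Zarhin2021PrimeOrderJacobians, §1 (1.4)–(1.6) (chunk p0003 L38–L47, L106–L112)] -/
theorem eigenMultiplicity_pow_val_mul_eq (hδ : (cyclotomic p ℤ).eval₂ (Int.castRingHom (End A)) (End.of δ) = 0)
    (hζ : IsPrimitiveRoot ζ p) (e h : (ZMod p)ˣ) :
    eigenMultiplicity A (End.asHom (End.of δ ^ (e : ZMod p).val)) (ζ ^ ((h * e : (ZMod p)ˣ) : ZMod p).val) =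
      eigenMultiplicity A δ (ζ ^ (h : ZMod p).val) := by
  have hval : ζ ^ ((h * e : (ZMod p)ˣ) : ZMod p).val = (ζ ^ (h : ZMod p).val) ^ (e : ZMod p).val := by
    rw [Units.val_mul, ZMod.val_mul, ← pow_eq_pow_mod _ hζ.pow_eq_one, pow_mul]
  rw [hval]
  exact eigenMultiplicity_pow_pow_eq_of_cyclotomic hp.out.pos hδ (ZMod.val_coe_unit_coprime e)
    ((hζ.pow_of_coprime _ (ZMod.val_coe_unit_coprime h)).pow_eq_one)

/-- **Zarhin's function of the generator `δ^{𝐣(e)}` is `h ↦ 𝐚_δ(h·e⁻¹)`: `n_{ζ^h}(δ^{𝐣(e)}) = n_{ζ^{h e⁻¹}}(δ)`** for `e, h ∈ G`.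
[cite: Zarhin2021PrimeOrderJacobians, §1 (1.4)–(1.6) (chunk p0003 L38–L47, L106–L112)] -/
theorem eigenMultiplicity_pow_val_eq (hδ : (cyclotomic p ℤ).eval₂ (Int.castRingHom (End A)) (End.of δ) = 0)
    (hζ : IsPrimitiveRoot ζ p) (e h : (ZMod p)ˣ) :
    eigenMultiplicity A (End.asHom (End.of δ ^ (e : ZMod p).val)) (ζ ^ (h : ZMod p).val) =
      eigenMultiplicity A δ (ζ ^ ((h * e⁻¹ : (ZMod p)ˣ) : ZMod p).val) := by
  have h1 := eigenMultiplicity_pow_val_mul_eq hδ hζ e (h * e⁻¹)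
  rwa [inv_mul_cancel_right] at h1

/-- **The inverse generator: `n_{ζ^h}(δ^{p−1}) = n_{ζ^{−h}}(δ)`** — Zarhin's function of `δ⁻¹ = δ^{p−1}` is `h ↦ 𝐚_δ(−h)`
(g35-#5 `eigenMultiplicity_pow_pred_eq`, `(ζ^h)⁻¹ = ζ^{−h}`). [cite: Zarhin2021PrimeOrderJacobians, §1 Example 1.3 (chunk p0003 L100–L104)] -/
theorem eigenMultiplicity_pow_pred_val_eq (hδ : (cyclotomic p ℤ).eval₂ (Int.castRingHom (End A)) (End.of δ) = 0)
    (hζ : IsPrimitiveRoot ζ p) (h : (ZMod p)ˣ) :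
    eigenMultiplicity A (End.asHom (End.of δ ^ (p - 1))) (ζ ^ (h : ZMod p).val) =
      eigenMultiplicity A δ (ζ ^ ((-h : (ZMod p)ˣ) : ZMod p).val) := by
  rw [eigenMultiplicity_pow_pred_eq hp.out.pos (pow_eq_one_of_cyclotomic hδ)]
  congr 1
  rw [Units.val_neg, ZMod.neg_val, if_neg h.ne_zero]
  exact (eq_inv_of_mul_eq_one_left (by rw [← pow_add, Nat.sub_add_cancel (ZMod.val_lt _).le, hζ.pow_eq_one])).symm

end PrimeTwist

end AbelianVariety

end Literature.AlgebraicGeometry.HodgeTheory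

end
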